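import Summits.CriticalPhenomena.PercolationContinuityZ3.Theorems.PercNearOneGluingNoHeavyPcintKernZ4B5Defs
import HarnessLib

/-!
# PCINT lane, kernel check 2/4 of the B3r window certificate `d = 4`, memory 5 (4-step windows, 4096 codes): codes `1024 ≤ c < 2048`

Cell `prim-pcint`, seat `prim-pcint-2` (gen 2).  Collatz–Wielandt rows `10^5 · row ≤ 99999 · DEN · v` for the window codes in
`[1024, 2048)`, by `decide +kernel` in chunks of `128` codes (natural-number arithmetic only; `maxHeartbeats 0`).
Does NOT build on p205010.
-/

namespace Summit.CriticalPhenomena.PercolationContinuityZ3.Theorems.Pcint.Z4B5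

set_option maxHeartbeats 0 in
/-- Rows `1024 ≤ c < 1152` of the certificate hold. [folklore] -/
theorem chk_1024_1152 : chk 1024 1152 = true := by decide +kernel

set_option maxHeartbeats 0 in
/-- Rows `1152 ≤ c < 1280` of the certificate hold. [folklore] -/
theorem chk_1152_1280 : chk 1152 1280 = true := by decide +kernel

set_option maxHeartbeats 0 in
/-- Rows `1280 ≤ c < 1408` of the certificate hold. [folklore] -/
theorem chk_1280_1408 : chk 1280 1408 = true := by decide +kernel

set_option maxHeartbeats 0 in
/-- Rows `1408 ≤ c < 1536` of the certificate hold. [folklore] -/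
theorem chk_1408_1536 : chk 1408 1536 = true := by decide +kernel

set_option maxHeartbeats 0 in
/-- Rows `1536 ≤ c < 1664` of the certificate hold. [folklore] -/
theorem chk_1536_1664 : chk 1536 1664 = true := by decide +kernel

set_option maxHeartbeats 0 in
/-- Rows `1664 ≤ c < 1792` of the certificate hold. [folklore] -/
theorem chk_1664_1792 : chk 1664 1792 = true := by decide +kernel

set_option maxHeartbeats 0 in
/-- Rows `1792 ≤ c < 1920` of the certificate hold. [folklore] -/
theorem chk_1792_1920 : chk 1792 1920 = true := by decide +kernel

set_option maxHeartbeats 0 in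
/-- Rows `1920 ≤ c < 2048` of the certificate hold. [folklore] -/
theorem chk_1920_2048 : chk 1920 2048 = true := by decide +kernel

/-- Rows `1024 ≤ c < 2048` of the certificate hold. [folklore] -/
theorem chkFile_2 : chk 1024 2048 = true :=
  chk_split (chk_split (chk_split (chk_split (chk_split (chk_split (chk_split chk_1024_1152 chk_1152_1280) chk_1280_1408) chk_1408_1536) chk_1536_1664) chk_1664_1792) chk_1792_1920) chk_1920_2048

end Summit.CriticalPhenomena.PercolationContinuityZ3.Theorems.Pcint.Z4B5
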